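import Mathlib
import Summits.Langlands.Langlands.Theses.PicardMuOrdinary
import Literature.NumberTheory.GaloisRepresentations.GaloisRep
import Literature.NumberTheory.GaloisRepresentations.FramedRepEquivConj
import Literature.NumberTheory.GaloisRepresentations.RestrictFieldSemisimple
import Literature.NumberTheory.Automorphic.ReciprocityGLn
import Literature.NumberTheory.Automorphic.ReciprocityGLnProofs
import Literature.NumberTheory.Automorphic.ReciprocityGLnGaloisConjProofs
import Literature.NumberTheory.Automorphic.BaseChangeArchimedean
import Literature.NumberTheory.Automorphic.BaseChangeArchimedeanDescent
import Literature.NumberTheory.Automorphic.TunnellOctahedralGlobal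
import Literature.NumberTheory.Automorphic.AutomorphicTwistNorm
import Literature.NumberTheory.Automorphic.ArchParameterTwistNorm
import Literature.NumberTheory.Automorphic.AlgebraicityParityGL
import Literature.NumberTheory.Automorphic.IdeleNormDetGL
import Summits.Langlands.Langlands.Theorems.PicardMuOrdinaryMuOrdinaryFamilyRTQuadraticDescentClifford
import Summits.Langlands.Langlands.Theorems.PicardMuOrdinaryMuOrdinaryFamilyRTQuadraticDescent
import HarnessLib

/-!
# Irregular quadratic descent `L → K` of automorphy, CONDITIONAL on reciprocity for the
# descended representations (line `split-ramified-prime-sqrt6`, crux `IrregularClassicality`,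
# stmt-Langlands-13758: the descent half of the registered stub `stub_irregularDescentUntwist`)

`K = ℚ(ω)`, `L/K` quadratic, `ρ : Γ_K → GL₃(ℚ̄₃)` with `ρ|_{Γ_L}` absolutely irreducible, `π_L`
cuspidal `L`-algebraic on `GL₃(𝔸_L)` compatible with `ρ|_{Γ_L}` off a finite `S'` in Buzzard–Gee's
normalisation `m = 1` (arithmetic Frobenius polynomial `∏ (X − ι⁻¹ β_j⁻¹)`).  The registered stub
wants a cuspidal `L`-algebraic `π'` on `GL₃(𝔸_K)` compatible with `ρ` (then the untwist of the
sibling file `…IrregularDescentUntwist` concludes).  Arthur–Clozel's cyclic descent gives weak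
descents `P`, `P ⊗ η_{L/K}` of `π_L`, but WHICH of the two is compatible with `ρ` at the primes of
`K` inert in `L` is invisible on the automorphic side (only the squares of the Satake parameters
are seen over `L`); with Galois representations attached to the two candidates the index-two
Clifford dichotomy decides (as in the sibling crux's `stub_quadraticDescent_of`, where the
candidates are REGULAR algebraic and lang.S27 supplies the representations).  Here the candidates
are `L`-algebraic of irregular weight, and the existence of their Galois representations is
Buzzard–Gee's Conjecture 3.2.1 (known on `U(2,1)` for limits of discrete series by
Goldring–Koskivirta 2019, not in the tree and not reachable from the typed data).  This file proves
the descent CONDITIONALLY on that reciprocity input, stated as an explicit hypothesis `H_gal` for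
the `L`-algebraic cuspidal representations of `GL₃(𝔸_K)`, and on the tree's named facts
`cuspidal_descent_cyclic`, `exists_twist_quadraticSign`, `ArthurClozel1989_strongLifting_archimedean`,
`AutomorphicRepData.exists_hasInfinityType`:

    stub_irregularDescent_of : cuspidal_descent_cyclic → exists_twist_quadraticSign →
      ArthurClozel1989_strongLifting_archimedean → (∀ …, Q.exists_hasInfinityType) →
      ∀ hcpt ι ρ L … hcptL, [L:K] = 2 → AbsIrr ρ|_L → H_gal →
      ∀ π_L S', π_L L-algebraic → (compatible with ρ|_L off S', m = 1) →
      ∃ π' S'', π' cuspidal L-algebraic on GL₃/K ∧ (compatible with ρ off S'', m = 1)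

Proof.  Normalisations: the tree's `IsGaloisCompatibleAt` is the `m = n = 3` clause, so we pass to
`Π = π_L ⊗ |det|` (Satake `q_w⁻¹ β`, `arithFrobPolyOfSatake ι q 3 (q⁻¹β) = arithFrobPolyOfSatake ι q 1 β`;
`L`-algebraic, an integral twist), run the sibling's argument on `Π` — stability of Satake data
(`isGaloisStableSatakeAE_of_isGaloisCompatibleAt`), descent `P` (`cuspidal_descent_cyclic`), twist
`P'' = P ⊗ η` (`exists_twist_quadraticSign`, also a weak descent), `L`-algebraicity of every weak
descent (`isLAlgebraic_descent'`), Galois representations of `P₁ ⊗ |det|⁻¹` from `H_gal` read back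
in the `m = 3` normalisation for `P₁`, `r|_L ≅ ρ|_L` by Chebotarev–Brauer–Nesbitt
(`nonempty_equiv_of_eventually_isGaloisCompatibleAt`), Clifford (`clifford_index_two`,
`not_conj_of_twist_quadraticSign`, `n = 3` odd) — and return `π' = P₁ ⊗ |det|⁻¹`.

References: J. Arthur, L. Clozel, Ann. of Math. Stud. 120 (1989), Ch. 3 Thm. 4.2 (d), Thm. 5.1;
K. Buzzard, T. Gee (2014), Conj. 3.2.1, §3.1; W. Goldring, J.-S. Koskivirta, Invent. Math. 217
(2019), §10; A. H. Clifford, Ann. of Math. 38 (1937).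
-/

open scoped NumberField Classical MatrixGroups
open Field IsDedekindDomain Polynomial Filter NumberField
open Literature.NumberTheory.GaloisRepresentations Literature.NumberTheory.Automorphic
open Summit.Langlands.Langlands.Cruxes.MuOrdinaryFamilyRT.CharZeroDominance
  (K isCMField_K finite_setOf_natCast_mem isWeakBaseChangeLiftAE_of_twist_quadraticSign
    clifford_index_two exists_quadChar mul_self_eq_one_of_quadChar eq_conj_of_twist_conj_eq
    not_conj_of_twist_quadraticSign isGaloisStableSatakeAE_of_isGaloisCompatibleAt)

set_option linter.dupNamespace false -- project-wide option; `Summit.Langlands.Langlands` is the mandated namespace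

noncomputable section

namespace Summit.Langlands.Langlands.Theorems.IrregularClassicality.SplitRamifiedPrimeSqrt6

/-! ## Normalisations: `m = 1` versus `m = 3`, and the twists `π ⊗ |det|^{∓1}` -/

section Normalisation

variable {ℓ : ℕ} [Fact ℓ.Prime]

/-- `arithFrobPolyOfSatake ι q 3 (q⁻¹ · β) = arithFrobPolyOfSatake ι q 1 β` (`(√q)² q⁻¹ = 1`). -/
theorem arithFrobPolyOfSatake_three_map_inv_mul (ι : PadicAlgCl ℓ ≃+* ℂ) {q : ℕ} (hq : q ≠ 0)
    (β : Multiset ℂ) :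
    arithFrobPolyOfSatake ι q 3 (β.map (((q : ℂ) ^ (-(1 : ℂ))) * ·)) = arithFrobPolyOfSatake ι q 1 β := by
  have hsqrt : ((Real.sqrt q : ℝ) : ℂ) ^ (3 - 1) = (q : ℂ) := by
    rw [show (3 - 1 : ℕ) = 2 from rfl, ← Complex.ofReal_pow, Real.sq_sqrt (Nat.cast_nonneg q),
      Complex.ofReal_natCast]
  have hq' : (q : ℂ) ≠ 0 := by exact_mod_cast hq
  rw [arithFrobPolyOfSatake, arithFrobPolyOfSatake_one, Multiset.map_map]
  refine congrArg _ (Multiset.map_congr rfl fun b _ => ?_)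
  simp only [Function.comp_apply, hsqrt, Complex.cpow_neg_one, ← mul_assoc, mul_inv_cancel₀ hq', one_mul]

/-- `arithFrobPolyOfSatake ι q 1 (q · α) = arithFrobPolyOfSatake ι q 3 α`. -/
theorem arithFrobPolyOfSatake_one_map_mul (ι : PadicAlgCl ℓ ≃+* ℂ) {q : ℕ} (hq : q ≠ 0)
    (α : Multiset ℂ) :
    arithFrobPolyOfSatake ι q 1 (α.map (((q : ℂ) ^ (-(-1 : ℂ))) * ·)) = arithFrobPolyOfSatake ι q 3 α := by
  rw [← arithFrobPolyOfSatake_three_map_inv_mul ι hq, Multiset.map_map]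
  have hq' : (q : ℂ) ≠ 0 := by exact_mod_cast hq
  have e : ((fun x : ℂ => (q : ℂ) ^ (-(1 : ℂ)) * x) ∘ fun x : ℂ => (q : ℂ) ^ (-(-1 : ℂ)) * x) = id := by
    funext x
    simp only [Function.comp_apply, neg_neg, Complex.cpow_one, Complex.cpow_neg_one, ← mul_assoc,
      inv_mul_cancel₀ hq', one_mul, id_eq]
  rw [e, Multiset.map_id]

variable {n : ℕ} {M : Type} [Field M] [NumberField M] {hM : isCompact_glFiniteIntegralLevel n M}

/-- **The integral norm twist `π ⊗ |det|_𝔸^m` of a cuspidal `L`-algebraic `π`** (`n ≥ 1`,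
`m ∈ ℤ`): cuspidal, `L`-algebraic (infinity type `T.twist m`), with Satake parameter `q_v^{-m} α`
at EVERY place where `π` has Satake parameter `α` (Borel–Jacquet 1979, 5.7;
`exists_cuspidalAutomorphicRepData_map_mulChar_detTwist`, `HasSatakeParamAt.of_map_mulChar_detTwist_of_cpow`,
`HasInfinityType.of_map_mulChar_detTwist`). -/
theorem exists_normTwist_int [NeZero n] (π : CuspidalAutomorphicRepData n M hM)
    (hπ : π.1.IsLAlgebraic) (m : ℤ) :
    ∃ π' : CuspidalAutomorphicRepData n M hM, π'.1.IsLAlgebraic ∧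
      ∀ (v : HeightOneSpectrum (𝓞 M)) (α : Multiset ℂ), π.1.HasSatakeParamAt v α →
        π'.1.HasSatakeParamAt v (α.map (((v.residueCard : ℂ) ^ (-(m : ℂ))) * ·)) := by
  obtain ⟨χ, hχ⟩ := exists_heckeCharacter_ideleNorm_cpow (K := M) ((m : ℝ) : ℂ)
  obtain ⟨π', hW, hW'⟩ := exists_cuspidalAutomorphicRepData_map_mulChar_detTwist hχ π
  obtain ⟨T, hT, hTL⟩ := hπ
  have hm : ((m : ℝ) : ℂ) = (m : ℂ) := Complex.ofReal_intCast m
  refine ⟨π', ⟨T.twist (m : ℝ), AutomorphicRepData.HasInfinityType.of_map_mulChar_detTwist hχ hW hW' hT,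
    by rw [hm]; exact hTL.twist_intCast m⟩, fun v α hα => ?_⟩
  have h := AutomorphicRepData.HasSatakeParamAt.of_map_mulChar_detTwist_of_cpow hχ hW hW' hα
  rwa [hm] at h

end Normalisation

/-! ## The conditional descent -/

/-- **Irregular quadratic descent `L → K` of automorphy, conditional on reciprocity for the
descended representations.**  Hypotheses: the tree's named facts `cuspidal_descent_cyclic`
(Arthur–Clozel Ch. 3 Thm. 4.2 (d)), `exists_twist_quadraticSign`,
`ArthurClozel1989_strongLifting_archimedean` with `exists_hasInfinityType` (Clozel 1990 §3.3); and
`H_gal`: every cuspidal `L`-algebraic `P₁` on `GL₃(𝔸_K)`, `K = ℚ(ω)`, has a semisimple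
`r : Γ_K → GL₃(ℚ̄₃)` with `charpoly r(Frob_v) = ∏ (X − ι⁻¹ α_j⁻¹)` for the Satake parameter `α` of
`P₁` at almost every `v` (Buzzard–Gee 2014, Conj. 3.2.1 in weak form; OPEN in this generality —
for the representations at hand it is Goldring–Koskivirta's theorem on `U(2,1)`).  Conclusion:
for `L/K` quadratic, `ρ|_{Γ_L}` absolutely irreducible and `π_L` cuspidal `L`-algebraic on
`GL₃(𝔸_L)` compatible with `ρ|_{Γ_L}` off `S'` (`m = 1`), some cuspidal `L`-algebraic `π'` on
`GL₃(𝔸_K)` is compatible with `ρ` off a finite `S''` — the hypothesis of the corrected stub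
`stub_irregularDescentUntwist`.  See the module docstring for the proof. -/
theorem stub_irregularDescent_of :
    cuspidal_descent_cyclic → exists_twist_quadraticSign → ArthurClozel1989_strongLifting_archimedean →
    (∀ (N : ℕ) (M : Type) [Field M] [NumberField M] (hM : isCompact_glFiniteIntegralLevel N M)
      (Q : AutomorphicRepData (AutomorphyDatum.gl N M hM)), Q.exists_hasInfinityType) →
    ∀ (hcpt : isCompact_glFiniteIntegralLevel 3 (CyclotomicField 3 ℚ)) (ι : PadicAlgCl 3 ≃+* ℂ)
      (ρ : FramedGaloisRep (CyclotomicField 3 ℚ) (PadicAlgCl 3) 3)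
      (L : Type) [Field L] [NumberField L] [Algebra (CyclotomicField 3 ℚ) L]
      (hcptL : isCompact_glFiniteIntegralLevel 3 L),
      Module.finrank (CyclotomicField 3 ℚ) L = 2 →
      FramedRep.IsAbsolutelyIrreducible (ρ.restrictField L) →
      (∀ P₁ : CuspidalAutomorphicRepData 3 (CyclotomicField 3 ℚ) hcpt, P₁.1.IsLAlgebraic →
        ∃ r : FramedGaloisRep (CyclotomicField 3 ℚ) (PadicAlgCl 3) 3, r.toGaloisRep.IsSemisimple ∧
          ∀ᶠ v : HeightOneSpectrum (𝓞 (CyclotomicField 3 ℚ)) in Filter.cofinite, ∀ α : Multiset ℂ,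
            P₁.1.HasSatakeParamAt v α →
              r.IsUnramifiedAt v ∧ r.HasFrobCharpolyAt v (arithFrobPolyOfSatake ι v.residueCard 1 α)) →
    ∀ (πL : CuspidalAutomorphicRepData 3 L hcptL) (S' : Finset (HeightOneSpectrum (𝓞 L))),
      πL.1.IsLAlgebraic →
      (∀ w ∉ S', ∃ β : Multiset ℂ, πL.1.HasSatakeParamAt w β ∧
        (ρ.restrictField L).IsUnramifiedAt w ∧
        (ρ.restrictField L).HasFrobCharpolyAt w (arithFrobPolyOfSatake ι w.residueCard 1 β)) →
    ∃ (π' : CuspidalAutomorphicRepData 3 (CyclotomicField 3 ℚ) hcpt)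
      (S'' : Finset (HeightOneSpectrum (𝓞 (CyclotomicField 3 ℚ)))),
      π'.1.IsLAlgebraic ∧
      ∀ 𝔭 ∉ S'', ∃ α : Multiset ℂ, π'.1.HasSatakeParamAt 𝔭 α ∧
        ρ.IsUnramifiedAt 𝔭 ∧ ρ.HasFrobCharpolyAt 𝔭 (arithFrobPolyOfSatake ι 𝔭.residueCard 1 α) := by
  intro hdesc htw hArch hInf hcpt ι ρ L _ _ _ hcptL hdeg hirr Hgal πL S' hLalg hcompat
  -- Galois theory of the quadratic extension `L/K`
  haveI : FiniteDimensional K L := Module.finite_of_finrank_eq_succ hdeg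
  haveI : Algebra.IsQuadraticExtension K L := ⟨hdeg⟩
  haveI : IsGalois K L := inferInstance
  have hprime : (Module.finrank K L).Prime := by rw [hdeg]; exact Nat.prime_two
  have hcyc : IsCyclic (L ≃ₐ[K] L) :=
    isCyclic_of_prime_card (p := Module.finrank K L) (hp := ⟨hprime⟩)
      (IsGalois.card_aut_eq_finrank K L)
  -- (0) `Π = π_L ⊗ |det|`: Satake `q_w⁻¹ β`, compatible with `ρ|_L` in the `m = 3` normalisation
  obtain ⟨PL, hPLalg, hPLS⟩ := exists_normTwist_int πL hLalg 1
  have hae : ∀ᶠ w : HeightOneSpectrum (𝓞 L) in cofinite,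
      PL.1.IsUnramifiedAt w ∧ IsGaloisCompatibleAt PL.1 ι (ρ.restrictField L) w := by
    have h1 : ∀ᶠ w : HeightOneSpectrum (𝓞 L) in cofinite, w ∉ S' := by
      rw [eventually_cofinite]
      simpa only [not_not, Finset.setOf_mem] using S'.finite_toSet
    refine h1.mono fun w hw => ?_
    obtain ⟨β, hβ, hunr, hF⟩ := hcompat w hw
    have hPLβ := hPLS w β hβ
    refine ⟨⟨_, hPLβ⟩, fun α hα => ⟨hunr, ?_⟩⟩
    rw [PL.1.hasSatakeParamAt_unique_holds hα hPLβ, Int.cast_one,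
      arithFrobPolyOfSatake_three_map_inv_mul ι (zero_lt_one.trans w.one_lt_residueCard).ne']
    exact hF
  -- (1) stability, weak descent `P`, twisted descent `P''`
  have hstab : IsGaloisStableSatakeAE K PL.1 :=
    isGaloisStableSatakeAE_of_isGaloisCompatibleAt PL.1 ι ρ hae
  obtain ⟨P, hBC⟩ := hdesc 3 K L hcpt hcptL hcyc hprime PL hstab
  obtain ⟨P'', htwP⟩ := htw 3 K L hdeg hcpt P
  have hBC'' : IsWeakBaseChangeLiftAE P''.1 PL.1 :=
    isWeakBaseChangeLiftAE_of_twist_quadraticSign hdeg hBC htwP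
  -- (2) every weak descent is `L`-algebraic and (by `H_gal`) has a Galois representation,
  --     compatible in the `m = 3` normalisation and conjugate to `ρ` on `Γ_L`
  have hirr' : (ρ.restrictField L).IsIrreducible := hirr.isIrreducible
  have hρss : (ρ.restrictField L).toGaloisRep.IsSemisimple := by
    haveI : IsSimpleOrder (Subrepresentation (ρ.restrictField L).toRepresentation) := hirr'
    change ComplementedLattice (Subrepresentation (ρ.restrictField L).toRepresentation)
    infer_instance
  have hS27' : ∀ P₁ : CuspidalAutomorphicRepData 3 K hcpt, IsWeakBaseChangeLiftAE P₁.1 PL.1 →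
      P₁.1.IsLAlgebraic ∧ ∃ r : FramedGaloisRep K (PadicAlgCl 3) 3,
        (∀ᶠ v : HeightOneSpectrum (𝓞 K) in cofinite, IsGaloisCompatibleAt P₁.1 ι r v) ∧
        ∃ Q : GL (Fin 3) (PadicAlgCl 3), r.restrictField L = (ρ.restrictField L).conj Q := by
    intro P₁ hBC₁
    have hL₁ : P₁.1.IsLAlgebraic :=
      hArch.isLAlgebraic_descent' hcyc hprime hBC₁ (hInf 3 K hcpt P₁.1) hPLalg
    -- `P₁♭ = P₁ ⊗ |det|⁻¹`, Satake `q_v α`, and its Galois representation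
    obtain ⟨P₁', hL₁', hS₁'⟩ := exists_normTwist_int P₁ hL₁ (-1)
    obtain ⟨r, hrss, hrc⟩ := Hgal P₁' hL₁'
    have hcK : ∀ᶠ v : HeightOneSpectrum (𝓞 K) in cofinite, IsGaloisCompatibleAt P₁.1 ι r v := by
      refine hrc.mono fun v hv α hα => ?_
      obtain ⟨hunr, hF⟩ := hv _ (hS₁' v α hα)
      refine ⟨hunr, ?_⟩
      rw [Int.cast_neg, Int.cast_one, arithFrobPolyOfSatake_one_map_mul ι (zero_lt_one.trans v.one_lt_residueCard).ne'] at hF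
      exact hF
    have hcF' := eventually_isGaloisCompatibleAt_restrictField P₁.1 PL.1 hBC₁ ι r hcK
    obtain ⟨e⟩ := nonempty_equiv_of_eventually_isGaloisCompatibleAt PL.1 ι (ρ.restrictField L)
      (r.restrictField L) hρss (r.isSemisimple_restrictField hrss) (hae.mono fun w hw => hw.2) hcF'
    obtain ⟨Q, hQ⟩ := FramedRep.exists_eq_conj_of_equiv _ _ e
    exact ⟨hL₁, r, hcK, Q, hQ⟩
  -- (3) Clifford: `ρ` is conjugate to `r(P₁)` for `P₁ = P` or `P₁ = P''`
  obtain ⟨P₁, hL₁, r₁, Q₁, hrc₁, hρ⟩ : ∃ P₁ : CuspidalAutomorphicRepData 3 K hcpt,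
      P₁.1.IsLAlgebraic ∧
      ∃ (r₁ : FramedGaloisRep K (PadicAlgCl 3) 3) (Q₁ : GL (Fin 3) (PadicAlgCl 3)),
        (∀ᶠ v : HeightOneSpectrum (𝓞 K) in cofinite, IsGaloisCompatibleAt P₁.1 ι r₁ v) ∧
        ρ = r₁.conj Q₁ := by
    obtain ⟨χ, hχ₁, hχ₂⟩ := exists_quadChar (A := PadicAlgCl 3) (L := K) (E := L) hdeg
    obtain ⟨hLP, r, hcK, Q, hQ⟩ := hS27' P hBC
    rcases clifford_index_two hdeg ρ r hirr' Q hQ χ hχ₁ hχ₂ with h | h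
    · exact ⟨P, hLP, r, Q⁻¹, hcK, h⟩
    obtain ⟨hLP'', r'', hc''K, Q'', hQ''⟩ := hS27' P'' hBC''
    rcases clifford_index_two hdeg ρ r'' hirr' Q'' hQ'' χ hχ₁ hχ₂ with h'' | h''
    · exact ⟨P'', hLP'', r'', Q''⁻¹, hc''K, h''⟩
    -- both twisted: `r''` would be conjugate to `r`
    exfalso
    have hconj := eq_conj_of_twist_conj_eq χ (mul_self_eq_one_of_quadChar χ hχ₁ hχ₂) r r'' Q⁻¹ Q''⁻¹
      (h''.symm.trans h)
    exact not_conj_of_twist_quadraticSign (by decide) hdeg P.1 P''.1 ι r r'' _ htwP hcK hc''K hconj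
  -- (4) the output `π' = P₁ ⊗ |det|⁻¹`, compatible with `ρ = Q₁ r₁ Q₁⁻¹` in the `m = 1` normalisation
  obtain ⟨π', hL', hS'⟩ := exists_normTwist_int P₁ hL₁ (-1)
  have hgood : ∀ᶠ 𝔭 : HeightOneSpectrum (𝓞 K) in cofinite, ∃ α : Multiset ℂ,
      π'.1.HasSatakeParamAt 𝔭 α ∧ ρ.IsUnramifiedAt 𝔭 ∧
        ρ.HasFrobCharpolyAt 𝔭 (arithFrobPolyOfSatake ι 𝔭.residueCard 1 α) := by
    filter_upwards [hrc₁, P₁.1.hasSatakeParamAt_cofinite_holds] with 𝔭 h𝔭 ⟨α₀, hα₀⟩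
    refine ⟨_, hS' 𝔭 α₀ hα₀, ?_⟩
    rw [Int.cast_neg, Int.cast_one, arithFrobPolyOfSatake_one_map_mul ι (zero_lt_one.trans 𝔭.one_lt_residueCard).ne', hρ,
      FramedGaloisRep.isUnramifiedAt_conj_iff, FramedGaloisRep.hasFrobCharpolyAt_conj_iff]
    exact h𝔭 α₀ hα₀
  rw [eventually_cofinite] at hgood
  refine ⟨π', hgood.toFinset, hL', fun 𝔭 h𝔭 => ?_⟩
  by_contra hcon
  exact h𝔭 (hgood.mem_toFinset.mpr hcon)

end Summit.Langlands.Langlands.Theorems.IrregularClassicality.SplitRamifiedPrimeSqrt6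

end
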